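import Literature.AlgebraicGeometry.Resolution.KollarBlowupSequenceFunctors
import HarnessLib

/-!
# `Kollar2007Principalization` (Kollár 2007, Thm. 3.21, weak form) — discharge glue

Topic: `Literature/AlgebraicGeometry/Resolution`. Sibling proofs file of
`PrincipalizationToResolution.lean` (which cannot import the later layers: `KollarOrderReduction`
imports it). The named fact `Kollar2007Principalization` (Kollár 2007, Thm. 3.21, p. 124) is
reduced IN THE TREE, by proved implications, to Kollár's two inductive steps:

* `Kollar2007MarkedOrderReduction.kollar2007Principalization` (`KollarOrderReduction.lean`,
  Kollár 3.72: Thm. 3.69 with `E = ∅`, `m = 1` ⟹ Thm. 3.21);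
* `kollar2007MarkedOrderReduction_of_inDim` and `Kollar2007Thm3_103.orderReduction`
  (`KollarBlowupSequenceFunctors.lean`, Kollár 3.70: Thms. 3.103 + 3.107 ⟹ Thms. 3.68/3.69 in
  every dimension ⟹ `Kollar2007MarkedOrderReduction`).

This file records the composite `Kollar2007Thm3_103 → Kollar2007Thm3_107 → Kollar2007Principalization`;
the closed discharge `Kollar2007Principalization_holds` is the same term applied to
`Kollar2007Thm3_103_holds` and `Kollar2007Thm3_107_holds` once those named facts (Kollár 2007,
Thms. 3.103 and 3.107, §§3.12–3.13) are discharged.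

## Sources

* J. Kollár, *Lectures on Resolution of Singularities*, Ann. of Math. Stud. 166, PUP 2007:
  Thm. 3.21 (p. 124), 3.70 and Thms. 3.68–3.69 (p. 150), 3.72 (p. 151), Thm. 3.103 (p. 171),
  Thm. 3.107 (p. 175) — page numbers of the held copy
  (`book:kollar2007-lectures-resolution-singularities`). [Kollar2007]
-/

noncomputable section

namespace Literature.AlgebraicGeometry.Resolution

universe u

/-- **Kollár 2007, Thm. 3.21 (weak form `Kollar2007Principalization`) from Thms. 3.103 and 3.107**:
the two inductive steps give Thm. 3.69 in every dimension (3.70), hence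
`Kollar2007MarkedOrderReduction` (Thm. 3.69 (1), `E = ∅`), hence Thm. 3.21 (3.72).
[cite: Kollar2007, 3.70 and 3.72 (pp. 150–151)] -/
theorem Kollar2007Thm3_103.kollar2007Principalization (h103 : Kollar2007Thm3_103.{u})
    (h107 : Kollar2007Thm3_107.{u}) : Kollar2007Principalization.{u} :=
  (kollar2007MarkedOrderReduction_of_inDim fun n => (h103.orderReduction h107 n).2).kollar2007Principalization

end Literature.AlgebraicGeometry.Resolution

end
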